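import Literature.AlgebraicGeometry.Resolution.AlterationsStrictTransformHolds
import Literature.AlgebraicGeometry.Resolution.GaloisSplittingField
import Literature.AlgebraicGeometry.Resolution.ResidueFieldsIntegralMorphisms
import Mathlib.AlgebraicGeometry.Morphisms.FormallyUnramified
import HarnessLib

/-!
# De Jong 1996, 4.16: the residue fields of `Z` over the generic point and a Galois extension splitting them

Topic: `Literature/AlgebraicGeometry/Resolution`. Second helper file toward the discharge of the
named fact `DeJong1996GaloisNormalization` (`AlterationsStrictTransform.lean`; de Jong 1996, 4.16):

> "Let `Z = ⋃ᵢ₌₁ⁿ Zᵢ` be the decomposition into irreducible components of `Z`. Choose a finite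
> separable Galois extension `k(Y) ⊂ L` such that `k(Zᵢ)` may be embedded over `k(Y)` into `L`
> for all `i`; this is possible as the field extensions `k(Y) ⊂ k(Zᵢ)` are finite separable by
> (vi) d)." (p. 71)

The function fields `k(Zᵢ)` of the components of `Z` dominating `Y` are the residue fields
`κ(ξ)` of `X` at the points `ξ ∈ Z` over the generic point `η` of `Y` (for the reduced structure
`Z_red`, whose generic stalks are its residue fields). Everything here is PROVED:

* `finite_residueField_of_comp`, `isSeparable_residueField_of_comp` — finiteness and
  separability of `κ(x')/κ((i ≫ f) x')` pass to `κ(i x')/κ(f(i x'))` along the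
  `κ(f(i x'))`-algebra map `κ(i x') → κ(x')` (used for the closed immersion `Z_red ↪ X` and the
  open immersion of the étale locus of `f|_Z`);
* `finite_isSeparable_residueField_of_isFiniteGenericallyEtaleOn` — **(vi) d) ⇒ for every
  `ξ ∈ Z` over `η`, `κ(ξ)` is finite separable over `κ(η)`**: finite because `f|_Z` is finite
  (`Scheme.Hom.finite_residueField_of_isFinite`), separable because `ξ`, a generic point of a
  component of `Z_red` (`f|_Z` finite), lies in the dense open étale locus, and étale morphisms
  have separable residue field extensions (Mathlib);
* `exists_galoisField_splits_residueField` — **the Galois extension `L ⊇ κ(η)` of 4.16**: finite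
  Galois over `κ(η)`, in which the minimal polynomial over `κ(η)` of every element of every
  `κ(ξ)`, `ξ ∈ Z` over `η` (finitely many), splits (`exists_isGalois_splits_minpoly`: the
  compositum of normal closures);
* `finite_isSeparable_functionField_of_residueField` — bookkeeping `K(Y) = κ(η)`: an extension
  finite separable over `κ(η)` is finite separable over the function field `K(Y) = 𝒪_{Y,η}`.

## Sources

* A. J. de Jong, *Smoothness, semi-stability and alterations*, Publ. Math. IHÉS 83 (1996), 4.16
  (p. 71). [DeJong1996]
* The Stacks Project, Tag 02GL (étale ring maps have separable residue field extensions).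
-/

noncomputable section

open CategoryTheory CategoryTheory.Limits AlgebraicGeometry TopologicalSpace Topology

namespace Literature.AlgebraicGeometry.Resolution

universe u

/-! ## Residue field extensions along `i ≫ f` and along `f` at `i x'` -/

section Transfer

variable {X' X Y : Scheme.{u}} (i : X' ⟶ X) (f : X ⟶ Y) (x' : X')

/-- **Finiteness descends along `κ(i x') → κ(x')`**: if `κ(x')` is finite over `κ((i ≫ f) x')`
(through `i ≫ f`), then `κ(i x')` is finite over `κ(f (i x'))` (through `f`) — `κ(i x') → κ(x')`
is an injective `κ(f (i x'))`-linear map. [folklore] -/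
theorem finite_residueField_of_comp
    (h : letI := ((i ≫ f).residueFieldMap x').hom.toAlgebra
      Module.Finite (Y.residueField ((i ≫ f) x')) (X'.residueField x')) :
    letI := (f.residueFieldMap (i x')).hom.toAlgebra
    Module.Finite (Y.residueField (f (i x'))) (X.residueField (i x')) := by
  letI a1 : Algebra (Y.residueField (f (i x'))) (X'.residueField x') :=
    (f.residueFieldMap (i x') ≫ i.residueFieldMap x').hom.toAlgebra
  letI a2 : Algebra (Y.residueField (f (i x'))) (X.residueField (i x')) :=
    (f.residueFieldMap (i x')).hom.toAlgebra
  haveI h1 : Module.Finite (Y.residueField (f (i x'))) (X'.residueField x') := by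
    rw [Scheme.residueFieldMap_comp] at h
    exact h
  let e : X.residueField (i x') →ₐ[Y.residueField (f (i x'))] X'.residueField x' :=
    { (i.residueFieldMap x').hom with commutes' := fun _ => rfl }
  exact Module.Finite.of_injective e.toLinearMap (i.residueFieldMap x').hom.injective

/-- **Separability descends along `κ(i x') → κ(x')`**: if `κ(x')` is separable over
`κ((i ≫ f) x')` (through `i ≫ f`), then `κ(i x')` is separable over `κ(f (i x'))` (through `f`)
(`Algebra.IsSeparable.of_algHom`). [folklore] -/
theorem isSeparable_residueField_of_comp
    (h : letI := ((i ≫ f).residueFieldMap x').hom.toAlgebra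
      Algebra.IsSeparable (Y.residueField ((i ≫ f) x')) (X'.residueField x')) :
    letI := (f.residueFieldMap (i x')).hom.toAlgebra
    Algebra.IsSeparable (Y.residueField (f (i x'))) (X.residueField (i x')) := by
  letI a1 : Algebra (Y.residueField (f (i x'))) (X'.residueField x') :=
    (f.residueFieldMap (i x') ≫ i.residueFieldMap x').hom.toAlgebra
  letI a2 : Algebra (Y.residueField (f (i x'))) (X.residueField (i x')) :=
    (f.residueFieldMap (i x')).hom.toAlgebra
  haveI h1 : Algebra.IsSeparable (Y.residueField (f (i x'))) (X'.residueField x') := by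
    rw [Scheme.residueFieldMap_comp] at h
    exact h
  let e : X.residueField (i x') →ₐ[Y.residueField (f (i x'))] X'.residueField x' :=
    { (i.residueFieldMap x').hom with commutes' := fun _ => rfl }
  exact Algebra.IsSeparable.of_algHom _ _ e

end Transfer

/-! ## Moving the base point: `κ(f x)` versus `κ(y)` for `f x = y` -/

section Congr

variable {X Y : Scheme.{u}} (f : X ⟶ Y) (x : X) {y : Y} (hx : f x = y)

/-- For `f x = y`, finiteness and separability of `κ(x)` over `κ(f x)` are the same as over
`κ(y)` through `κ(y) ≅ κ(f x) → κ(x)`. [folklore] -/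
theorem finite_isSeparable_residueField_congr
    (h : letI := (f.residueFieldMap x).hom.toAlgebra
      Module.Finite (Y.residueField (f x)) (X.residueField x) ∧
        Algebra.IsSeparable (Y.residueField (f x)) (X.residueField x)) :
    letI := ((Y.residueFieldCongr hx).inv ≫ f.residueFieldMap x).hom.toAlgebra
    Module.Finite (Y.residueField y) (X.residueField x) ∧
      Algebra.IsSeparable (Y.residueField y) (X.residueField x) := by
  subst hx
  have e : (Y.residueFieldCongr rfl).inv ≫ f.residueFieldMap x = f.residueFieldMap x := by simp
  rw [e]
  exact h

end Congr

/-! ## (vi) d) ⇒ the residue fields of `Z` over `η` are finite separable over `κ(η)` -/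

section Fields

open Scheme.IdealSheafData DeJong1996

variable {X Y : Scheme.{u}} (f : X ⟶ Y)

/-- **De Jong 1996, 4.16: "the field extensions `k(Y) ⊂ k(Zᵢ)` are finite separable by
(vi) d)"** — at the level of residue fields: let `Z ⊆ X` be closed with `f|_Z : Z_red → Y` finite
and generically étale (`DeJong1996.IsFiniteGenericallyEtaleOn f Z`), `X` noetherian, `Y`
integral. Then for every `ξ ∈ Z` over the generic point `η` of `Y`, `κ(ξ)` is finite and
separable over `κ(η)` (through `f`): finite as `f|_Z` is finite; separable as `ξ` is a generic
point of a component of `Z_red` (no specialisations in the fibres of the finite `f|_Z`), hence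
lies in the dense open étale locus of `f|_Z`, where residue field extensions are separable.
[cite: DeJong1996, 4.16, p. 71] -/
theorem finite_isSeparable_residueField_of_isFiniteGenericallyEtaleOn [NoetherianSpace X]
    [IsIntegral Y] {Z : Set X} (hZ : IsClosed Z) (hd : IsFiniteGenericallyEtaleOn f Z) {x : X}
    (hxZ : x ∈ Z) (hx : f x = genericPoint Y) :
    letI := (f.residueFieldMap x).hom.toAlgebra
    Module.Finite (Y.residueField (f x)) (X.residueField x) ∧
      Algebra.IsSeparable (Y.residueField (f x)) (X.residueField x) := by
  have eZ : (⟨closure Z, isClosed_closure⟩ : Closeds X) = ⟨Z, hZ⟩ := by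
    ext1
    exact hZ.closure_eq
  unfold IsFiniteGenericallyEtaleOn at hd
  rw [eZ] at hd
  obtain ⟨hfin, V₀, hV₀d, hV₀et⟩ := hd
  haveI := hfin
  haveI := hV₀et
  set zι := (vanishingIdeal (⟨Z, hZ⟩ : Closeds X)).subschemeι with hzι
  haveI : NoetherianSpace (vanishingIdeal (⟨Z, hZ⟩ : Closeds X)).subscheme :=
    zι.isClosedEmbedding.isEmbedding.isInducing.noetherianSpace
  -- `x = zι z` with `z` in the étale locus `V₀`
  obtain ⟨z, rfl⟩ : x ∈ Set.range zι := by rw [range_subschemeι_vanishingIdeal]; exact hxZ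
  have hzV₀ : z ∈ V₀ :=
    DeJong1996.StrictTransform.mem_of_dense_of_mem_genericPoints V₀.isOpen hV₀d
      (DeJong1996.StrictTransform.mem_genericPoints_of_apply_eq_genericPoint (zι ≫ f) hx)
  obtain ⟨w, rfl⟩ : z ∈ Set.range V₀.ι := by rw [Scheme.Opens.range_ι]; exact hzV₀
  -- over `Z_red` at `z = V₀.ι w`: finite (as `f|_Z` is finite) and separable (étale on `V₀`)
  have hfinz := Scheme.Hom.finite_residueField_of_isFinite (zι ≫ f) (V₀.ι w)
  have hsepz : letI := ((zι ≫ f).residueFieldMap (V₀.ι w)).hom.toAlgebra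
      Algebra.IsSeparable (Y.residueField ((zι ≫ f) (V₀.ι w)))
        ((vanishingIdeal (⟨Z, hZ⟩ : Closeds X)).subscheme.residueField (V₀.ι w)) := by
    refine isSeparable_residueField_of_comp V₀.ι (zι ≫ f) w ?_
    haveI : Etale (V₀.ι ≫ zι ≫ f) := hV₀et
    infer_instance
  exact ⟨finite_residueField_of_comp zι f (V₀.ι w) hfinz,
    isSeparable_residueField_of_comp zι f (V₀.ι w) hsepz⟩

/-- The points of `Z` over a point `y` are finite in number when `f|_Z : Z_red → Y` is finite.
[folklore] -/
theorem finite_inter_preimage_singleton_of_isFinite {Z : Set X} (hZ : IsClosed Z)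
    [IsFinite ((vanishingIdeal ⟨Z, hZ⟩).subschemeι ≫ f)] (y : Y) :
    (Z ∩ f ⁻¹' {y}).Finite := by
  set zι := (vanishingIdeal (⟨Z, hZ⟩ : Closeds X)).subschemeι with hzι
  refine (((zι ≫ f).finite_preimage_singleton y).image zι).subset ?_
  rintro x ⟨hxZ, hxy⟩
  obtain ⟨w, rfl⟩ : x ∈ Set.range zι := by rw [range_subschemeι_vanishingIdeal]; exact hxZ
  exact ⟨w, show (zι ≫ f) w ∈ ({y} : Set Y) by rw [Scheme.Hom.comp_apply]; exact hxy, rfl⟩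

/-- **De Jong 1996, 4.16: "Choose a finite separable Galois extension `k(Y) ⊂ L` such that
`k(Zᵢ)` may be embedded over `k(Y)` into `L` for all `i`; this is possible as the field
extensions `k(Y) ⊂ k(Zᵢ)` are finite separable by (vi) d)."** For `Z ⊆ X` closed with `f|_Z`
finite and generically étale (`X` noetherian, `Y` integral with generic point `η`), there is a
finite Galois extension `L` of `κ(η)` such that for every `ξ ∈ Z` over `η`, `κ(ξ)` is algebraic
over `κ(η)` (through `κ(η) ≅ κ(f ξ) → κ(ξ)`) and the minimal polynomial over `κ(η)` of every
element of `κ(ξ)` splits in `L` (there are finitely many such `ξ`, each `κ(ξ)` finite separable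
over `κ(η)`; take the compositum of normal closures, `exists_isGalois_splits_minpoly`).
[cite: DeJong1996, 4.16, p. 71] -/
theorem exists_galoisField_splits_residueField [NoetherianSpace X] [IsIntegral Y] {Z : Set X}
    (hZ : IsClosed Z) (hd : IsFiniteGenericallyEtaleOn f Z) :
    ∃ (L : Type u) (_ : Field L) (_ : Algebra (Y.residueField (genericPoint Y)) L),
      FiniteDimensional (Y.residueField (genericPoint Y)) L ∧
        IsGalois (Y.residueField (genericPoint Y)) L ∧
          ∀ (x : X) (_ : x ∈ Z) (hx : f x = genericPoint Y),
            letI := ((Y.residueFieldCongr hx).inv ≫ f.residueFieldMap x).hom.toAlgebra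
            Algebra.IsAlgebraic (Y.residueField (genericPoint Y)) (X.residueField x) ∧
              ∀ t : X.residueField x, ((minpoly (Y.residueField (genericPoint Y)) t).map
                (algebraMap (Y.residueField (genericPoint Y)) L)).Splits := by
  let K : Type u := ↥(Y.residueField (genericPoint Y))
  -- the finitely many points of `Z` over `η`
  let S : Type u := {x : X // x ∈ Z ∧ f x = genericPoint Y}
  have hfinZ : IsFinite ((vanishingIdeal ⟨Z, hZ⟩).subschemeι ≫ f) := by
    have eZ : (⟨closure Z, isClosed_closure⟩ : Closeds X) = ⟨Z, hZ⟩ := by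
      ext1
      exact hZ.closure_eq
    have h := hd.1
    rw [eZ] at h
    exact h
  haveI : Finite S := by
    have hf : (Z ∩ f ⁻¹' {genericPoint Y}).Finite :=
      finite_inter_preimage_singleton_of_isFinite f hZ (genericPoint Y)
    exact hf.to_subtype
  -- their residue fields as `κ(η)`-algebras
  let E : S → Type u := fun i => X.residueField i.1
  letI : ∀ i : S, Algebra K (E i) := fun i =>
    ((Y.residueFieldCongr i.2.2).inv ≫ f.residueFieldMap i.1).hom.toAlgebra
  have key : ∀ i : S, Module.Finite K (E i) ∧ Algebra.IsSeparable K (E i) := fun i =>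
    finite_isSeparable_residueField_congr f i.1 i.2.2
      (finite_isSeparable_residueField_of_isFiniteGenericallyEtaleOn f hZ hd i.2.1 i.2.2)
  haveI : ∀ i : S, FiniteDimensional K (E i) := fun i => (key i).1
  haveI : ∀ i : S, Algebra.IsSeparable K (E i) := fun i => (key i).2
  obtain ⟨L, _, _, hLfin, hLgal, -, hsplit⟩ := exists_isGalois_splits_minpoly K E
  refine ⟨L, inferInstance, inferInstance, hLfin, hLgal, fun x hxZ hx => ?_⟩
  exact ⟨Algebra.IsAlgebraic.of_finite K (E ⟨x, hxZ, hx⟩), fun t => hsplit ⟨x, hxZ, hx⟩ t⟩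

end Fields

/-! ## `K(Y) = κ(η)`: extensions of `κ(η)` as extensions of the function field -/

section FunctionField

variable (Y : Scheme.{u}) [IsIntegral Y] (L : Type u) [Field L]
  [Algebra (Y.residueField (genericPoint Y)) L]

/-- **An extension finite separable over `κ(η)` is finite separable over `K(Y) = 𝒪_{Y,η}`**
through the (bijective) residue map `𝒪_{Y,η} → κ(η)`: the tower `K(Y) → κ(η) → L`, whose bottom
storey is finite (a quotient) and separable (every element comes from `K(Y)`). [folklore] -/
theorem finite_isSeparable_functionField_of_residueField
    [FiniteDimensional (Y.residueField (genericPoint Y)) L]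
    [Algebra.IsSeparable (Y.residueField (genericPoint Y)) L] :
    letI := ((algebraMap (Y.residueField (genericPoint Y)) L).comp
      (Y.residue (genericPoint Y)).hom).toAlgebra
    FiniteDimensional Y.functionField L ∧ Algebra.IsSeparable Y.functionField L := by
  let K : Type u := ↥(Y.residueField (genericPoint Y))
  letI aKL : Algebra Y.functionField L :=
    ((algebraMap K L).comp (Y.residue (genericPoint Y)).hom).toAlgebra
  -- the bottom storey `K(Y) → κ(η)`
  letI aK : Algebra Y.functionField K := (Y.residue (genericPoint Y)).hom.toAlgebra
  haveI : IsScalarTower Y.functionField K L := IsScalarTower.of_algebraMap_eq fun _ => rfl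
  have hsurj : Function.Surjective (algebraMap Y.functionField K) :=
    Y.residue_surjective (genericPoint Y)
  haveI : Module.Finite Y.functionField K :=
    Module.Finite.of_surjective (Algebra.linearMap Y.functionField K) hsurj
  haveI : Algebra.IsSeparable Y.functionField K :=
    ⟨fun c => by
      obtain ⟨a, rfl⟩ := hsurj c
      exact isSeparable_algebraMap a⟩
  exact ⟨Module.Finite.trans K L, Algebra.IsSeparable.trans Y.functionField K L⟩

end FunctionField

end Literature.AlgebraicGeometry.Resolution

end
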